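import Literature.NumberTheory.EllipticCurves.PAdicLFunction
import Literature.NumberTheory.EllipticCurves.HeckeOperatorsDiamondCommProofs
import Mathlib.NumberTheory.ModularForms.CongruenceSubgroups
import Mathlib.GroupTheory.Abelianization.Defs
import Mathlib.GroupTheory.OrderOfElement
import HarnessLib

/-!
# The cyclotomic winding span: non-constancy of the plus symbol on `ℤ[1/p]` (carrier of a pair `(E, p)`)
# and the `Γ₀(N)` generation predicates behind it

Topic `NumberTheory/EllipticCurves/Rank1Residual` (namespace = path,
`Literature.NumberTheory.EllipticCurves.Rank1Residual`, alongside the pair predicates of `Predicates.lean`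
and the `(μ, λ)` carriers of `MuLambdaCarriers.lean`).  DEFINITIONS ONLY — `Prop`-valued PREDICATES with
explicit binders, each the transcription of a printed notion (cited) — plus unfolding / bookkeeping lemmas,
all proved; NO named fact (no closed `Prop` awaiting a `_holds`), nothing asserted about any curve or level.

Written by the typer seat `ty2` of cell `bsd-print-x8` (D-0131 (2) PRINT TIER, HOME
`run/shared/lean/pub/bsd-print-x8/`) on the planner's ask T-VS (2026-08-27): ONE carrier file so that the
two cells that type statements over these notions — `bsd-f3-mu` (lens `-an`, MEMO-an §10 / §12, sketches
`an/Sketch2.lean`, `an/g3/Sketch3.lean`: candidates AN-4 … AN-8 over `CycWindingNonConstantAt`) and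
`bsd-print-x8` (line «vertical Stevens at 3», `plan/vs/SketchVS.lean`: VS-1 `CycWindingNonConstantSmallImageX8`,
VS-0 over `EisSpanGen`) — cite ONE declaration each (D-0064).  The Summits-side statements (class-wide
claims, the cells' candidate items, glue) are NOT here.

## The printed notions transcribed

* §1 `CycWindingNonConstantAt W p` — for every newform `f` of `W`: SOME two `p`-power-denominator rationals
  `a/pⁿ, a'/pⁿ` have plus symbols `[a/pⁿ]⁺_f`, `[a'/pⁿ]⁺_f` (the tree's `ratPlusSymbol f`, conventions of
  `PAdicLFunction.lean`: `[r]⁺ = re({∞,r}+{∞,−r})/2 / Ω⁺_f`, `re Λ_f = ℤ·Ω⁺_f/2`) with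
  `1 ≤ ‖[a/pⁿ]⁺ − [a'/pⁿ]⁺‖_p`.  The numbers `[a/pⁿ]⁺` are exactly the values fed to the
  Mazur–Swinnerton-Dyer / Mazur–Tate–Teitelbaum measure `μ(a + pⁿℤ_p) = α⁻ⁿ[a/pⁿ]⁺ − α⁻ⁿ⁻¹[a/pⁿ⁻¹]⁺`
  [Mazur–Tate–Teitelbaum 1986, §I.10 (10.1)] (tree: `msdMeasure`) and to the Mazur–Tate elements
  (tree: `PlusMinusPAdicLFunction.mazurTateElement`); for `p ∤ N` the class `{a'/pⁿ → a/pⁿ}` is CLOSED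
  (both cusps are `Γ₀(N)`-equivalent to `0`), so the difference lies in `re Λ_f/Ω⁺_f = ½ℤ` and, for odd
  `p`, the inequality literally says «not divisible by `p`».  The homology classes `{0 → a/ℓⁿ}` and the
  submodule of `H₁(X₀(N);ℤ)` they generate are the object of [Sun 2007, §4] (his `M_n(ℓ)`, with the index
  question (8) there and the numerics of his Appendix B).
* §2 the `Γ₀(N)` side, over Mathlib's `CongruenceSubgroup.Gamma0 N` only (no homology, no modular forms):
  by [Manin 1972, Prop. 1.4] the map `Γ₀(N) → H₁(X₀(N);ℤ)`, `g ↦ {a, g a}`, is a surjective homomorphism,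
  independent of `a`, whose kernel is generated by the commutators, the elliptic and the parabolic
  elements; with `a = 0` and `g = (a b; c d)`, `g·0 = b/d`, which is a `p`-power cusp iff `|d| = pᵐ`
  ([Sun 2007, §4]: `γ = (u a; Nv ℓⁿ) ↦ {0, a/ℓⁿ}`).  Hence «the `p`-power winding classes generate `H₁`
  up to the classes of `Γ_H(N) = {d ≡ ±pᵏ (mod N)}`» and its prime-to-`p` weakening become statements of
  combinatorial group theory: `ConjSpanGen N p`, `EisSpanGen N p` below (generation of `Γ_H(N)` by the
  GOOD elements `|d| = pᵐ`, the torsion elements and the trace-`±2` elements, modulo the commutator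
  subgroup), and the MOD-`p` form `EisSpanModGen N p` (also modulo `p`-th powers: «`pr Γ_H ⊆ V + p·H₁`», the
  statement an `𝔽_p`-rank computation certifies; `EisSpanGen ⟹ EisSpanModGen`, cell referee R-68).
* §3 LAYERS (line «layered Stevens at 3», `plan/ls/SketchLS.lean` VERBATIM): the single-layer test sets
  `goodLayer N p m` / `layerGenerators N p m` (Sun 2007 §4: `M_n(ℓ)` at ONE layer, statement (8), Example 9),
  `LayerEisSpanModGen N p m`, `LayerEisSpanTwoModGen N p`, the test-set form `SpanModBy N p S`, and the two-layer
  consumer carrier `CycWindingUnitTwoLayersAt W p` (unit differences `[b/pᵐ]⁺ − [0]⁺`, `[b'/pᵐ⁺¹]⁺ − [0]⁺`), with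
  `eisSpanModGen_of_layerEisSpanModGen`, `spanModBy_goodLayer_iff`, `spanModBy_setOf_isGoodAt_iff`,
  `cycWindingNonConstantAt_of_cycWindingUnitTwoLayersAt` and the one-newform transport.  Under «`(ℤ/N)ˣ = ⟨−1, p⟩`» (hypothesis (H_T) of `bsd-f3-mu`'s prime-level theorem, their
  `AnLens3.UnitsGenByNegOneAnd N p` — not re-declared here) `Γ_H(N) = Γ₀(N)` (`inGammaH_of_forall_isUnit`).

Design notes. (a) `CycWindingNonConstantAt` quantifies over the newforms of `W` at ANY level (implicit
`{N} [NeZero N]`), exactly as `TeichOrbitNonConstantAt` / `MuAnZeroAt` do; the Summits-side item spellings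
use an explicit `∀ (N : ℕ) (_ : NeZero N)` binder — `cycWindingNonConstantAt_iff_explicit` converts.
(a') ONE newform decides, granted Carayol's `N = N_E` (`cycWindingNonConstantAt_iff_of_isNewformOf`,
`hlev` as in `MuLambdaCarriers`): the level transport from a conductor-level certificate to the `∀ (N) (f)`
binder.  (b) One exponent `n` for both rationals is no loss (`cycWindingNonConstantAt_iff_twoLevel`: bring
`a/pⁿ, a'/pⁿ'` to the common denominator `pⁿ⁺ⁿ'`).  (c) The norm condition is decoded once and for all by
`one_le_norm_ratCast_iff`: `1 ≤ ‖(q : ℚ_[p])‖ ↔ q ≠ 0 ∧ padicValRat p q ≤ 0`.  (d) On the `Γ₀(N)` side the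
predicates are stated for every `N p : ℕ`; for `p ∣ N` they degenerate harmlessly (`InGammaH` forces
`d ≡ ±1`).  (e) Junk: none of the predicates has a junk branch; `ratPlusSymbol`'s own junk value `0` (no
rational plus symbol) makes `CycWindingNonConstantAt` FALSE off the rational-newform locus, never true.

References: [MazurTateTeitelbaum1986Invent] §I.8, §I.10 (10.1)–(10.2); [Manin1972] Prop. 1.4, Prop. 1.6;
[Sun2007] §4 and App. B; [Stevens1982] Ch. 1–3 (winding elements, Shimura covering `X₁(N) → X₀(N)`).
-/

noncomputable section

open scoped Classical MatrixGroups ModularForm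

namespace Literature.NumberTheory.EllipticCurves.Rank1Residual

open CongruenceSubgroup WeierstrassCurve
open Literature.NumberTheory.EllipticCurves
open Literature.NumberTheory.EllipticCurves.ModularForms

/-! ### §0 Decoding the norm condition `1 ≤ ‖(q : ℚ_[p])‖` -/

section NormDecode

variable {p : ℕ} [Fact p.Prime]

/-- For a rational number `q`, `1 ≤ ‖q‖_p` iff `q ≠ 0` and `ord_p q ≤ 0` (i.e. `q` is NOT divisible by `p`
in `ℤ_(p)`): `‖q‖_p = p^{−ord_p q}` for `q ≠ 0` and `‖0‖_p = 0`. [cite: Koblitz1984, Ch. I §2 (p. 2: |x|_p = p^(-ord_p x))] -/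
theorem one_le_norm_ratCast_iff (q : ℚ) :
    1 ≤ ‖((q : ℚ) : ℚ_[p])‖ ↔ q ≠ 0 ∧ padicValRat p q ≤ 0 := by
  have hp : (1 : ℚ) < p := by exact_mod_cast (Fact.out : p.Prime).one_lt
  rw [Padic.eq_padicNorm]
  by_cases hq : q = 0
  · subst hq
    simp
  · rw [padicNorm.eq_zpow_of_nonzero hq]
    constructor
    · intro h
      refine ⟨hq, ?_⟩
      have h' : (1 : ℚ) ≤ (p : ℚ) ^ (-padicValRat p q) := by exact_mod_cast h
      rw [one_le_zpow_iff_right₀ hp] at h'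
      omega
    · rintro ⟨-, h⟩
      have h' : (1 : ℚ) ≤ (p : ℚ) ^ (-padicValRat p q) := by
        rw [one_le_zpow_iff_right₀ hp]
        omega
      exact_mod_cast h'

/-- In particular `1 ≤ ‖q‖_p` forces `q ≠ 0`. [cite: Koblitz1984, Ch. I §2 (p. 2: |x|_p = p^(-ord_p x))] -/
theorem ne_zero_of_one_le_norm_ratCast {q : ℚ} (h : 1 ≤ ‖((q : ℚ) : ℚ_[p])‖) : q ≠ 0 :=
  ((one_le_norm_ratCast_iff q).mp h).1

/-- … and `ord_p q ≤ 0`. [cite: Koblitz1984, Ch. I §2 (p. 2: |x|_p = p^(-ord_p x))] -/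
theorem padicValRat_nonpos_of_one_le_norm_ratCast {q : ℚ} (h : 1 ≤ ‖((q : ℚ) : ℚ_[p])‖) :
    padicValRat p q ≤ 0 :=
  ((one_le_norm_ratCast_iff q).mp h).2

/-- A `p`-adic unit of `ℚ` (`q ≠ 0`, `ord_p q = 0`) has `1 ≤ ‖q‖_p`. [cite: Koblitz1984, Ch. I §2 (p. 2: |x|_p = p^(-ord_p x))] -/
theorem one_le_norm_ratCast_of_padicValRat_eq_zero {q : ℚ} (hq : q ≠ 0) (h : padicValRat p q = 0) :
    1 ≤ ‖((q : ℚ) : ℚ_[p])‖ :=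
  (one_le_norm_ratCast_iff q).mpr ⟨hq, h.le⟩

end NormDecode

/-! ### §1 The carrier: non-constancy of the plus symbol on `ℤ[1/p]` -/

section Carrier

/-- **`CycWindingNonConstantAt W p`** («the cyclotomic winding function of `E` is non-constant mod `p`»):
for every newform `f` of `W` (any level `N`, `IsNewformOf W f`) there are `p`-power-denominator rationals
`a/pⁿ, a'/pⁿ` whose rational plus symbols are NOT congruent mod `p`:
`1 ≤ ‖[a/pⁿ]⁺_f − [a'/pⁿ]⁺_f‖_p`, where `[r]⁺_f = ratPlusSymbol f r` (`= re({∞,r} + {∞,−r})/2 / Ω⁺_f`, the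
values of the Mazur–Swinnerton-Dyer measure, Mazur–Tate–Teitelbaum 1986 §I.10 (10.1); tree `msdMeasure`).
For `p ∤ N` the path `{a'/pⁿ → a/pⁿ}` is a closed class on `X₀(N)` (both end-points are `Γ₀(N)`-equivalent
to the cusp `0`), so the difference lies in `re Λ_f/Ω⁺_f = ½ℤ` and for odd `p` the condition reads
«`[a/pⁿ]⁺ ≢ [a'/pⁿ]⁺ (mod p)`»; these closed classes `{0 → a/ℓⁿ}` and the submodule of `H₁(X₀(N);ℤ)` they
generate are Sun's `M_n(ℓ)` (Sun 2007 §4).  A PREDICATE on the pair `(W, p)`; nothing is asserted.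
VERBATIM the carrier of `bsd-f3-mu` `an/Sketch2.lean` (`AnLens2.CycWindingNonConstantAt`) and of
`bsd-print-x8` `plan/vs/SketchVS.lean` (`VS.CycWindingNonConstantAt`).
[cite: MazurTateTeitelbaum1986Invent, §I.10 (10.1)] [cite: Sun2007, §4] -/
def CycWindingNonConstantAt (W : WeierstrassCurve ℚ) [W.IsGloballyMinimal] (p : ℕ) [Fact p.Prime] :
    Prop :=
  ∀ {N : ℕ} [NeZero N] (f : CuspForm (Gamma0 N) 2), IsNewformOf W f →
    ∃ (n : ℕ) (a a' : ℤ),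
      1 ≤ ‖((ratPlusSymbol f ((a : ℚ) / (p : ℚ) ^ n) - ratPlusSymbol f ((a' : ℚ) / (p : ℚ) ^ n) : ℚ) :
        ℚ_[p])‖

variable (W : WeierstrassCurve ℚ) [W.IsGloballyMinimal] (p : ℕ) [Fact p.Prime]

/-- Unfolding `CycWindingNonConstantAt`. [cite: MazurTateTeitelbaum1986Invent, §I.10 (10.1)] -/
theorem cycWindingNonConstantAt_iff :
    CycWindingNonConstantAt W p ↔
      ∀ {N : ℕ} [NeZero N] (f : CuspForm (Gamma0 N) 2), IsNewformOf W f →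
        ∃ (n : ℕ) (a a' : ℤ),
          1 ≤ ‖((ratPlusSymbol f ((a : ℚ) / (p : ℚ) ^ n) -
            ratPlusSymbol f ((a' : ℚ) / (p : ℚ) ^ n) : ℚ) : ℚ_[p])‖ :=
  Iff.rfl

/-- The same predicate with the EXPLICIT level binder `∀ (N : ℕ) (_ : NeZero N)` used by the Summits-side
item spellings (e.g. route `PrintX8`, VS-1 `CycWindingNonConstantSmallImageX8`). [cite: MazurTateTeitelbaum1986Invent, §I.10 (10.1)] -/
theorem cycWindingNonConstantAt_iff_explicit :
    CycWindingNonConstantAt W p ↔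
      ∀ (N : ℕ) (_ : NeZero N) (f : CuspForm (Gamma0 N) 2), IsNewformOf W f →
        ∃ (n : ℕ) (a a' : ℤ),
          1 ≤ ‖((ratPlusSymbol f ((a : ℚ) / (p : ℚ) ^ n) -
            ratPlusSymbol f ((a' : ℚ) / (p : ℚ) ^ n) : ℚ) : ℚ_[p])‖ :=
  ⟨fun h _ _ f hf ↦ h f hf, fun h N _ f hf ↦ h N inferInstance f hf⟩

/-- `CycWindingNonConstantAt` decoded through `padicValRat`: for every newform `f` of `W` some difference
`D = [a/pⁿ]⁺_f − [a'/pⁿ]⁺_f` is non-zero with `ord_p D ≤ 0`. [cite: MazurTateTeitelbaum1986Invent, §I.10 (10.1)] -/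
theorem cycWindingNonConstantAt_iff_padicValRat :
    CycWindingNonConstantAt W p ↔
      ∀ {N : ℕ} [NeZero N] (f : CuspForm (Gamma0 N) 2), IsNewformOf W f →
        ∃ (n : ℕ) (a a' : ℤ),
          ratPlusSymbol f ((a : ℚ) / (p : ℚ) ^ n) - ratPlusSymbol f ((a' : ℚ) / (p : ℚ) ^ n) ≠ 0 ∧
          padicValRat p
            (ratPlusSymbol f ((a : ℚ) / (p : ℚ) ^ n) - ratPlusSymbol f ((a' : ℚ) / (p : ℚ) ^ n)) ≤ 0 := by
  constructor
  · intro h N _ f hf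
    obtain ⟨n, a, a', h1⟩ := h f hf
    exact ⟨n, a, a', (one_le_norm_ratCast_iff _).mp h1⟩
  · intro h N _ f hf
    obtain ⟨n, a, a', h1⟩ := h f hf
    exact ⟨n, a, a', (one_le_norm_ratCast_iff _).mpr h1⟩

/-- Two exponents are no more general than one: if `1 ≤ ‖[a/pⁿ]⁺ − [a'/pⁿ']⁺‖_p` for some `n, n'`, then the
one-exponent form holds (common denominator `pⁿ⁺ⁿ'`), and conversely. [cite: MazurTateTeitelbaum1986Invent, §I.10 (10.1)] -/
theorem cycWindingNonConstantAt_iff_twoLevel :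
    CycWindingNonConstantAt W p ↔
      ∀ {N : ℕ} [NeZero N] (f : CuspForm (Gamma0 N) 2), IsNewformOf W f →
        ∃ (n n' : ℕ) (a a' : ℤ),
          1 ≤ ‖((ratPlusSymbol f ((a : ℚ) / (p : ℚ) ^ n) -
            ratPlusSymbol f ((a' : ℚ) / (p : ℚ) ^ n') : ℚ) : ℚ_[p])‖ := by
  constructor
  · intro h N _ f hf
    obtain ⟨n, a, a', h1⟩ := h f hf
    exact ⟨n, n, a, a', h1⟩
  · intro h N _ f hf
    obtain ⟨n, n', a, a', h1⟩ := h f hf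
    have hp0 : (p : ℚ) ≠ 0 := by exact_mod_cast (Fact.out : p.Prime).ne_zero
    refine ⟨n + n', a * p ^ n', a' * p ^ n, ?_⟩
    have e1 : ((a * p ^ n' : ℤ) : ℚ) / (p : ℚ) ^ (n + n') = (a : ℚ) / (p : ℚ) ^ n := by
      push_cast
      rw [pow_add]
      field_simp
    have e2 : ((a' * p ^ n : ℤ) : ℚ) / (p : ℚ) ^ (n + n') = (a' : ℚ) / (p : ℚ) ^ n' := by
      push_cast
      rw [pow_add]
      field_simp
    rw [e1, e2]
    exact h1

variable {W p} in
/-- Constructor: a newform-wise witness `D ≠ 0`, `ord_p D ≤ 0` gives `CycWindingNonConstantAt`. [cite: MazurTateTeitelbaum1986Invent, §I.10 (10.1)] -/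
theorem cycWindingNonConstantAt_of_padicValRat
    (h : ∀ {N : ℕ} [NeZero N] (f : CuspForm (Gamma0 N) 2), IsNewformOf W f →
      ∃ (n : ℕ) (a a' : ℤ),
        ratPlusSymbol f ((a : ℚ) / (p : ℚ) ^ n) - ratPlusSymbol f ((a' : ℚ) / (p : ℚ) ^ n) ≠ 0 ∧
        padicValRat p
          (ratPlusSymbol f ((a : ℚ) / (p : ℚ) ^ n) - ratPlusSymbol f ((a' : ℚ) / (p : ℚ) ^ n)) ≤ 0) :
    CycWindingNonConstantAt W p :=
  (cycWindingNonConstantAt_iff_padicValRat W p).mpr h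

variable {W p} in
/-- Eliminator at one newform: `CycWindingNonConstantAt W p` and a newform `f` of `W` give `n, a, a'` with
`D ≠ 0` and `ord_p D ≤ 0` (`D = [a/pⁿ]⁺_f − [a'/pⁿ]⁺_f`) — the starting point of the `p = 3` collapse
(cell `bsd-print-x8`, line VS, memo §2 (ii)). [cite: MazurTateTeitelbaum1986Invent, §I.10 (10.1)] -/
theorem CycWindingNonConstantAt.exists_sub_ne_zero (h : CycWindingNonConstantAt W p) {N : ℕ} [NeZero N]
    (f : CuspForm (Gamma0 N) 2) (hf : IsNewformOf W f) :
    ∃ (n : ℕ) (a a' : ℤ),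
      ratPlusSymbol f ((a : ℚ) / (p : ℚ) ^ n) - ratPlusSymbol f ((a' : ℚ) / (p : ℚ) ^ n) ≠ 0 ∧
      padicValRat p
        (ratPlusSymbol f ((a : ℚ) / (p : ℚ) ^ n) - ratPlusSymbol f ((a' : ℚ) / (p : ℚ) ^ n)) ≤ 0 :=
  (cycWindingNonConstantAt_iff_padicValRat W p).mp h f hf

variable {W p} in
/-- **One newform decides** (level transport).  Granted Carayol's `N = N_E` (`hlev`, the cite-only named
fact `IsNewformOf.level_eq_conductorNorm`, as in `MuLambdaCarriers.hasLambdaAnAt_iff_normLam_eq`), all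
newforms of `W` coincide (`IsNewformOf.unique`), so `CycWindingNonConstantAt W p` is the statement at any
ONE newform `f` of `W`.  This turns a conductor-level certificate (one curve, its newform `f₀`, one pair
`a/pⁿ, a'/pⁿ` with a unit difference of plus symbols) into the `∀ (N) (f)` binder of the Summits-side item
spellings (via `cycWindingNonConstantAt_iff_explicit`). [cite: Carayol1986] -/
theorem cycWindingNonConstantAt_iff_of_isNewformOf [W.IsElliptic]
    (hlev : ∀ (N : ℕ) [NeZero N], IsNewformOf.level_eq_conductorNorm (N := N))
    {N : ℕ} [NeZero N] {f : CuspForm (Gamma0 N) 2} (hf : IsNewformOf W f) :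
    CycWindingNonConstantAt W p ↔
      ∃ (n : ℕ) (a a' : ℤ),
        1 ≤ ‖((ratPlusSymbol f ((a : ℚ) / (p : ℚ) ^ n) -
          ratPlusSymbol f ((a' : ℚ) / (p : ℚ) ^ n) : ℚ) : ℚ_[p])‖ := by
  constructor
  · intro h
    exact h f hf
  · intro h M _ f₁ hf₁
    obtain rfl : M = W.conductorNorm ℤ := hlev M hf₁
    obtain rfl : N = W.conductorNorm ℤ := hlev N hf
    obtain rfl : f₁ = f := hf₁.unique hf
    exact h

variable {W p} in
/-- Constructor form of `cycWindingNonConstantAt_iff_of_isNewformOf`: ONE newform `f` of `W` and ONE pair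
`a/pⁿ, a'/pⁿ` with `1 ≤ ‖[a/pⁿ]⁺_f − [a'/pⁿ]⁺_f‖_p` give `CycWindingNonConstantAt W p` (granted Carayol's
`hlev`). [cite: Carayol1986] -/
theorem cycWindingNonConstantAt_of_isNewformOf [W.IsElliptic]
    (hlev : ∀ (N : ℕ) [NeZero N], IsNewformOf.level_eq_conductorNorm (N := N))
    {N : ℕ} [NeZero N] {f : CuspForm (Gamma0 N) 2} (hf : IsNewformOf W f) {n : ℕ} {a a' : ℤ}
    (h : 1 ≤ ‖((ratPlusSymbol f ((a : ℚ) / (p : ℚ) ^ n) -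
      ratPlusSymbol f ((a' : ℚ) / (p : ℚ) ^ n) : ℚ) : ℚ_[p])‖) :
    CycWindingNonConstantAt W p :=
  (cycWindingNonConstantAt_iff_of_isNewformOf hlev hf).mpr ⟨n, a, a', h⟩

variable {W p} in
/-- The same with the witness decoded through `padicValRat` (`D ≠ 0`, `ord_p D ≤ 0` — e.g. `ord_p D = 0` for
two `p`-integral symbols that differ by a unit). [cite: Carayol1986] -/
theorem cycWindingNonConstantAt_of_isNewformOf_of_padicValRat [W.IsElliptic]
    (hlev : ∀ (N : ℕ) [NeZero N], IsNewformOf.level_eq_conductorNorm (N := N))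
    {N : ℕ} [NeZero N] {f : CuspForm (Gamma0 N) 2} (hf : IsNewformOf W f) {n : ℕ} {a a' : ℤ}
    (h0 : ratPlusSymbol f ((a : ℚ) / (p : ℚ) ^ n) - ratPlusSymbol f ((a' : ℚ) / (p : ℚ) ^ n) ≠ 0)
    (hv : padicValRat p
      (ratPlusSymbol f ((a : ℚ) / (p : ℚ) ^ n) - ratPlusSymbol f ((a' : ℚ) / (p : ℚ) ^ n)) ≤ 0) :
    CycWindingNonConstantAt W p :=
  cycWindingNonConstantAt_of_isNewformOf hlev hf ((one_le_norm_ratCast_iff _).mpr ⟨h0, hv⟩)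

end Carrier

/-! ### §2 The `Γ₀(N)` side: good / torsion / parabolic generators and `Γ_H(N)`

Dictionary (not formalised here; Manin 1972 Prop. 1.4, Sun 2007 §4): `pr : Γ₀(N) ↠ H₁(X₀(N);ℤ)`,
`g ↦ {0 → g·0}`, kernel generated by commutators, elliptic (= finite order) and parabolic (= trace `±2`,
`≠ ±I`; `±I` die as well) elements; `g·0 = b/d` in lowest terms, so `{0 → g·0}` is a `p`-power winding
class iff `|d| = pᵐ` (GOOD `g`), and conversely every `{0 → a/pᵐ}` (`p ∤ N`) is `pr` of a good element
`(u a; Nv pᵐ)`.  So the span `V(N,p)` of the closed `p`-power winding classes is `pr ⟨good⟩`, it lies in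
`pr Γ_H(N)` with `Γ_H(N) = {d ≡ ±pᵏ (mod N)}`, and
* `V(N,p) = pr Γ_H(N)`  ⟺  `ConjSpanGen N p`;
* `pr Γ_H(N) / V(N,p)` is a torsion group of exponent prime to `p`  ⟺  `EisSpanGen N p` (then every additive
  map `H₁(X₀(N);ℤ) → 𝔽_p` vanishing on `V(N,p)` factors through `H₁ / pr Γ_H(N)`, a quotient of
  `(ℤ/N)ˣ/⟨±1, p⟩` — the «Eisenstein» classes of the Shimura covering `X_H(N) → X₀(N)`, Stevens 1982 Ch. 1). -/

section GroupTheory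

variable {N : ℕ}

/-- The lower-right entry `d` of `γ = (a b; c d) ∈ Γ₀(N)`, as an integer (Mathlib's `Gamma0Map N γ` is its
class mod `N`: `intCast_dEntry`). [folklore] -/
def dEntry (γ : Gamma0 N) : ℤ := (γ : SL(2, ℤ)) 1 1

/-- The trace `a + d` of `γ = (a b; c d) ∈ Γ₀(N)`. [folklore] -/
def trEntry (γ : Gamma0 N) : ℤ := (γ : SL(2, ℤ)) 0 0 + (γ : SL(2, ℤ)) 1 1

/-- `dEntry` reduces mod `N` to Mathlib's `CongruenceSubgroup.Gamma0Map`. [cite: Stevens1982, §1.1] -/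
@[simp] theorem intCast_dEntry (γ : Gamma0 N) : ((dEntry γ : ℤ) : ZMod N) = Gamma0Map N γ := rfl

/-- `d(I) = 1`. [cite: Stevens1982, §1.1] -/
@[simp] theorem dEntry_one : dEntry (1 : Gamma0 N) = 1 := by
  simp [dEntry]

/-- `tr(I) = 2`. [cite: Stevens1982, §1.1] -/
@[simp] theorem trEntry_one : trEntry (1 : Gamma0 N) = 2 := by
  simp [trEntry]

/-- GOOD elements of `Γ₀(N)` for the prime `p`: `|d| = pᵐ` for some `m`, i.e. `γ·0 = b/d` is a cusp with
`p`-power denominator, so `{0 → γ·0}` is a `p`-power winding class (Sun 2007 §4: `(u a; Nv ℓⁿ) ↦ {0, a/ℓⁿ}`).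
[cite: Sun2007, §4] -/
def IsGoodAt (p : ℕ) (γ : Gamma0 N) : Prop := ∃ m : ℕ, (dEntry γ).natAbs = p ^ m

/-- The generating SET of the span statements: the good elements (`|d| = pᵐ`), the elements of finite
order (elliptic elements and `±I`) and the elements of trace `±2` (parabolic elements and `±I`) of `Γ₀(N)`
— the last two kinds die in `H₁(X₀(N);ℤ)` (Manin 1972 Prop. 1.4).  VERBATIM `plan/vs/SketchVS.lean`
`spanGenerators`. [cite: Manin1972, Prop. 1.4] [cite: Sun2007, §4] -/
def spanGenerators (N p : ℕ) : Set (Gamma0 N) :=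
  {γ | (∃ m : ℕ, (dEntry γ).natAbs = p ^ m) ∨ IsOfFinOrder γ ∨ trEntry γ = 2 ∨ trEntry γ = -2}

/-- The subgroup the span statements compare `Γ_H(N)` with: generated by `spanGenerators N p`, times the
commutator subgroup of `Γ₀(N)` (everything is read in `Γ₀(N)ᵃᵇ ↠ H₁(X₀(N);ℤ)`). [cite: Manin1972, Prop. 1.4] -/
def spanSubgroup (N p : ℕ) : Subgroup (Gamma0 N) :=
  Subgroup.closure (spanGenerators N p) ⊔ commutator (Gamma0 N)

/-- `γ ∈ Γ_H(N)` for `H = ⟨±p⟩ ≤ (ℤ/N)ˣ`: the `d`-entry is `± a power of p` modulo `N`.  These are the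
elements whose classes in `H₁(X₀(N);ℤ)` map to zero in the Eisenstein quotient `(ℤ/N)ˣ/⟨±1, p, …⟩` attached
to the Shimura covering; every good element lies in `Γ_H(N)` (`inGammaH_of_isGoodAt`).  VERBATIM
`plan/vs/SketchVS.lean` `InGammaH` (`Γ_H(N)` is an «intermediate group of type `(N,1)`», `Γ₁(N) ⊆ Γ_H(N) ⊆ Γ₀(N)`,
in the sense of Stevens 1982 §1.1). [cite: Stevens1982, §1.1] -/
def InGammaH (N p : ℕ) (γ : Gamma0 N) : Prop :=
  ∃ k : ℕ, ((dEntry γ : ℤ) : ZMod N) = (p : ZMod N) ^ k ∨ ((dEntry γ : ℤ) : ZMod N) = -((p : ZMod N) ^ k)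

/-- **`ConjSpanGen N p`** — the span statement in GENERATION FORM: every `γ ∈ Γ₀(N)` with `d ≡ ±pᵏ (mod N)`
lies in the subgroup generated by the good, the finite-order and the trace-`±2` elements, times the
commutator subgroup.  Through Manin 1972 Prop. 1.4 this says: the closed `p`-power winding classes
`{0 → a/pᵐ}` span `pr Γ_H(N) ⊆ H₁(X₀(N);ℤ)`, i.e. `H₁(X₀(N);ℤ)/V(N,p)` is the (finite, Eisenstein) quotient
`H₁ / pr Γ_H(N)`; cf. the index statement (8) of Sun 2007 §4 for his `M_n(ℓ)`.  A PREDICATE on `(N, p)`;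
nothing asserted.  VERBATIM `plan/vs/SketchVS.lean` `ConjSpanGen` (with `spanSubgroup` unfolded there).
[cite: Manin1972, Prop. 1.4] [cite: Sun2007, §4] -/
def ConjSpanGen (N p : ℕ) : Prop :=
  ∀ γ : Gamma0 N, InGammaH N p γ →
    γ ∈ Subgroup.closure (spanGenerators N p) ⊔ commutator (Gamma0 N)

/-- **`EisSpanGen N p`** — the PRIME-TO-`p` weakening: some prime-to-`p` power of every `γ ∈ Γ_H(N)` lies in
that subgroup.  Through Manin 1972 Prop. 1.4: `pr Γ_H(N) / V(N,p)` is a torsion group of exponent prime to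
`p`, so every additive map `H₁(X₀(N);ℤ) → 𝔽_p` vanishing on the `p`-power winding classes factors through the
Eisenstein quotient `H₁ / pr Γ_H(N)`.  A PREDICATE on `(N, p)`; nothing asserted.  VERBATIM
`plan/vs/SketchVS.lean` `EisSpanGen`. [cite: Manin1972, Prop. 1.4] [cite: Sun2007, §4] -/
def EisSpanGen (N p : ℕ) : Prop :=
  ∀ γ : Gamma0 N, InGammaH N p γ → ∃ m : ℕ, ¬ p ∣ m ∧
    γ ^ m ∈ Subgroup.closure (spanGenerators N p) ⊔ commutator (Gamma0 N)

/-! #### Bookkeeping lemmas (all proved) -/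

/-- Unfolding `ConjSpanGen` through `spanSubgroup`. [cite: Manin1972, Prop. 1.4] -/
theorem conjSpanGen_iff (N p : ℕ) :
    ConjSpanGen N p ↔ ∀ γ : Gamma0 N, InGammaH N p γ → γ ∈ spanSubgroup N p := Iff.rfl

/-- Unfolding `EisSpanGen` through `spanSubgroup`. [cite: Manin1972, Prop. 1.4] -/
theorem eisSpanGen_iff (N p : ℕ) :
    EisSpanGen N p ↔ ∀ γ : Gamma0 N, InGammaH N p γ → ∃ m : ℕ, ¬ p ∣ m ∧ γ ^ m ∈ spanSubgroup N p :=
  Iff.rfl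

/-- `spanSubgroup` contains the subgroup generated by `spanGenerators`. [cite: Manin1972, Prop. 1.4] -/
theorem closure_le_spanSubgroup (N p : ℕ) : Subgroup.closure (spanGenerators N p) ≤ spanSubgroup N p :=
  le_sup_left

/-- `spanSubgroup` contains the commutator subgroup. [cite: Manin1972, Prop. 1.4] -/
theorem commutator_le_spanSubgroup (N p : ℕ) : commutator (Gamma0 N) ≤ spanSubgroup N p :=
  le_sup_right

/-- Generators lie in `spanSubgroup`. [cite: Manin1972, Prop. 1.4] -/
theorem mem_spanSubgroup_of_mem_spanGenerators {N p : ℕ} {γ : Gamma0 N} (h : γ ∈ spanGenerators N p) :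
    γ ∈ spanSubgroup N p :=
  closure_le_spanSubgroup N p (Subgroup.subset_closure h)

/-- Good elements are generators. [cite: Manin1972, Prop. 1.4] -/
theorem mem_spanGenerators_of_isGoodAt {N p : ℕ} {γ : Gamma0 N} (h : IsGoodAt p γ) :
    γ ∈ spanGenerators N p :=
  Or.inl h

/-- Finite-order elements (elliptic elements, `±I`) are generators. [cite: Manin1972, Prop. 1.4] -/
theorem mem_spanGenerators_of_isOfFinOrder {N p : ℕ} {γ : Gamma0 N} (h : IsOfFinOrder γ) :
    γ ∈ spanGenerators N p :=
  Or.inr (Or.inl h)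

/-- Trace-`2` elements (parabolic elements, `I`) are generators. [cite: Manin1972, Prop. 1.4] -/
theorem mem_spanGenerators_of_trEntry_eq_two {N p : ℕ} {γ : Gamma0 N} (h : trEntry γ = 2) :
    γ ∈ spanGenerators N p :=
  Or.inr (Or.inr (Or.inl h))

/-- Trace-`−2` elements (parabolic elements, `−I`) are generators. [cite: Manin1972, Prop. 1.4] -/
theorem mem_spanGenerators_of_trEntry_eq_neg_two {N p : ℕ} {γ : Gamma0 N} (h : trEntry γ = -2) :
    γ ∈ spanGenerators N p :=
  Or.inr (Or.inr (Or.inr h))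

/-- An element with `d = ±1` is good (`m = 0`). [cite: Sun2007, §4] -/
theorem isGoodAt_of_natAbs_dEntry_eq_one {N : ℕ} (p : ℕ) {γ : Gamma0 N} (h : (dEntry γ).natAbs = 1) :
    IsGoodAt p γ :=
  ⟨0, by simpa using h⟩

/-- `I` is a generator. [cite: Manin1972, Prop. 1.4] -/
theorem one_mem_spanGenerators (N p : ℕ) : (1 : Gamma0 N) ∈ spanGenerators N p :=
  mem_spanGenerators_of_isGoodAt (isGoodAt_of_natAbs_dEntry_eq_one p (by simp))

/-- `1 ∈ Γ_H(N)` (`k = 0`). [cite: Stevens1982, §1.1] -/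
theorem inGammaH_one (N p : ℕ) : InGammaH N p (1 : Gamma0 N) :=
  ⟨0, Or.inl (by simp)⟩

/-- `Γ_H(N)` is closed under multiplication (`(±pᵏ)(±pˡ) = ±pᵏ⁺ˡ`; the `d`-entry is multiplicative mod `N`
on `Γ₀(N)`: `Gamma0Map` is a homomorphism). [cite: Stevens1982, §1.1] -/
theorem InGammaH.mul {N p : ℕ} {γ δ : Gamma0 N} (hγ : InGammaH N p γ) (hδ : InGammaH N p δ) :
    InGammaH N p (γ * δ) := by
  obtain ⟨k, hk⟩ := hγ
  obtain ⟨l, hl⟩ := hδ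
  refine ⟨k + l, ?_⟩
  simp only [intCast_dEntry, map_mul] at hk hl ⊢
  rcases hk with hk | hk <;> rcases hl with hl | hl <;> simp [hk, hl, pow_add]

/-- Good elements lie in `Γ_H(N)`: `|d| = pᵐ` gives `d ≡ ±pᵐ`. [cite: Sun2007, §4] -/
theorem inGammaH_of_isGoodAt {N p : ℕ} {γ : Gamma0 N} (h : IsGoodAt p γ) : InGammaH N p γ := by
  obtain ⟨m, hm⟩ := h
  refine ⟨m, ?_⟩
  rcases Int.natAbs_eq (dEntry γ) with h1 | h1
  · left
    rw [h1, hm]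
    push_cast
    rfl
  · right
    rw [h1, hm]
    push_cast
    rfl

/-- Under «`(ℤ/N)ˣ = ⟨−1, p⟩`» (every unit of `ℤ/N` is `±pᵏ` — hypothesis (H_T) of `bsd-f3-mu`'s THEOREM (T),
their `AnLens3.UnitsGenByNegOneAnd N p`, spelled out here) every element of `Γ₀(N)` lies in `Γ_H(N)` (its
`d`-entry is a unit mod `N`, `ModularForms.isUnit_Gamma0Map`), i.e. `Γ_H(N) = Γ₀(N)`. [cite: Stevens1982, §1.1] -/
theorem inGammaH_of_forall_isUnit {N p : ℕ}
    (h : ∀ x : ZMod N, IsUnit x → ∃ k : ℕ, x = (p : ZMod N) ^ k ∨ x = -((p : ZMod N) ^ k))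
    (γ : Gamma0 N) : InGammaH N p γ := by
  obtain ⟨k, hk⟩ := h (Gamma0Map N γ) (isUnit_Gamma0Map N γ)
  exact ⟨k, by simpa only [intCast_dEntry] using hk⟩

/-- Under «`(ℤ/N)ˣ = ⟨−1, p⟩`», `ConjSpanGen N p` says that the good, finite-order and trace-`±2` elements
generate `Γ₀(N)` modulo commutators — through Manin 1972 Prop. 1.4: ALL of `H₁(X₀(N);ℤ)` is spanned by the
closed `p`-power winding classes (the conclusion of `bsd-f3-mu`'s THEOREM (T) at prime level).
[cite: Manin1972, Prop. 1.4] -/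
theorem conjSpanGen_iff_top_of_forall_isUnit {N p : ℕ}
    (h : ∀ x : ZMod N, IsUnit x → ∃ k : ℕ, x = (p : ZMod N) ^ k ∨ x = -((p : ZMod N) ^ k)) :
    ConjSpanGen N p ↔ spanSubgroup N p = ⊤ := by
  constructor
  · intro hC
    rw [eq_top_iff]
    intro γ _
    exact hC γ (inGammaH_of_forall_isUnit h γ)
  · intro htop γ _
    change γ ∈ spanSubgroup N p
    rw [htop]
    exact Subgroup.mem_top γ

/-- The generation form implies the prime-to-`p` form (take `m = 1`; needs `p ≠ 1`).  VERBATIM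
`plan/vs/SketchVS.lean` `eisSpanGen_of_conjSpanGen`. [cite: Manin1972, Prop. 1.4] -/
theorem eisSpanGen_of_conjSpanGen {N p : ℕ} (hp : p ≠ 1) (h : ConjSpanGen N p) : EisSpanGen N p :=
  fun γ hγ ↦ ⟨1, fun hd ↦ hp (Nat.dvd_one.mp hd), by simpa using h γ hγ⟩

/-- If the span subgroup is everything (e.g. the good, torsion and parabolic elements generate `Γ₀(N)`
outright), both span statements hold for every `p`. [cite: Manin1972, Prop. 1.4] -/
theorem conjSpanGen_of_spanSubgroup_eq_top {N p : ℕ} (h : spanSubgroup N p = ⊤) : ConjSpanGen N p :=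
  fun γ _ ↦ by
    change γ ∈ spanSubgroup N p
    rw [h]
    exact Subgroup.mem_top γ

/-! #### `Γ_H(N)` versus `Γ₁(N)`: both span statements reduce to `Γ₁(N)`
(memo `plan/vs/LINE-VERTICAL-STEVENS-AT-3.md` §3: «CONJ(N,p) ⟺ the image of `H₁(X₁(N))` lies in the
`p`-power winding span»).  Every `γ ∈ Γ_H(N)` factors as `δ · e · g` with `δ ∈ Γ₁(N)`, `e ∈ {I, −I}` and
`g = (u, −w; N, pᵏ)` good (`InGammaH.exists_gamma1_mul`). -/

/-- `−I` as an element of `Γ₀(N)` (the tree has `ModularForms.DualForm.negOne` and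
`HaberlandAlgebra.neg_one_mem_Gamma0` behind heavy analytic imports; re-derived inline, as there, to keep
this carrier file's import closure small). [cite: Stevens1982, §1.1] -/
def negOneGamma0 (N : ℕ) : Gamma0 N := ⟨-1, by simp [Gamma0_mem]⟩

/-- `negOneGamma0` is `−I`. [cite: Stevens1982, §1.1] -/
@[simp] theorem coe_negOneGamma0 (N : ℕ) : ((negOneGamma0 N : Gamma0 N) : SL(2, ℤ)) = -1 := rfl

/-- `d(−I) ≡ −1`. [cite: Stevens1982, §1.1] -/
@[simp] theorem gamma0Map_negOneGamma0 (N : ℕ) : Gamma0Map N (negOneGamma0 N) = -1 := by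
  simp [Gamma0Map, negOneGamma0]

/-- `tr(−I) = −2`. [cite: Stevens1982, §1.1] -/
theorem trEntry_negOneGamma0 (N : ℕ) : trEntry (negOneGamma0 N) = -2 := by
  simp [trEntry, negOneGamma0]

/-- `(−I)² = I`. [cite: Stevens1982, §1.1] -/
theorem negOneGamma0_mul_negOneGamma0 (N : ℕ) : negOneGamma0 N * negOneGamma0 N = 1 := by
  ext i j
  simp [negOneGamma0]

/-- `−I` is a generator (trace `−2`; it is also of finite order). [cite: Manin1972, Prop. 1.4] -/
theorem negOneGamma0_mem_spanGenerators (N p : ℕ) : negOneGamma0 N ∈ spanGenerators N p :=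
  mem_spanGenerators_of_trEntry_eq_neg_two (trEntry_negOneGamma0 N)

/-- The good element `(u, −w; N, pᵏ)` of `Γ₀(N)` (`u·pᵏ + w·N = 1`), with `d`-entry exactly `pᵏ`; it exists
as soon as `pᵏ` is a unit mod `N` (Sun 2007 §4: `γ = (u a; Nv ℓⁿ) ∈ Γ₀(N)`, `{0, γ(0)} = {0, a/ℓⁿ}`).
[cite: Sun2007, §4] -/
theorem exists_isGoodAt_gamma0Map_eq_pow {N p : ℕ} (k : ℕ) (hu : IsUnit ((p : ZMod N) ^ k)) :
    ∃ g : Gamma0 N, IsGoodAt p g ∧ Gamma0Map N g = (p : ZMod N) ^ k := by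
  have hcop : (p ^ k).Coprime N := by
    rw [← ZMod.isUnit_iff_coprime]
    push_cast
    exact hu
  obtain ⟨u, w, huw⟩ := Nat.isCoprime_iff_coprime.mpr hcop
  have hdet : Matrix.det !![u, -w; (N : ℤ), ((p ^ k : ℕ) : ℤ)] = 1 := by
    rw [Matrix.det_fin_two_of]
    linear_combination huw
  refine ⟨⟨⟨!![u, -w; (N : ℤ), ((p ^ k : ℕ) : ℤ)], hdet⟩, ?_⟩, ⟨k, ?_⟩, ?_⟩
  · rw [Gamma0_mem]
    simp
  · simp [dEntry]
  · simp [Gamma0Map]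

/-- Decomposition of `Γ_H(N)`: every `γ` with `d ≡ ±pᵏ (mod N)` is `δ · e · g` with `δ ∈ Γ₁(N)`,
`e ∈ {I, −I}` and `g` good with `d`-entry `pᵏ`. [cite: Sun2007, §4] -/
theorem InGammaH.exists_gamma1_mul {N p : ℕ} {γ : Gamma0 N} (hγ : InGammaH N p γ) :
    ∃ (δ e g : Gamma0 N), δ ∈ Gamma1' N ∧ (e = 1 ∨ e = negOneGamma0 N) ∧ IsGoodAt p g ∧ γ = δ * e * g := by
  obtain ⟨k, hk⟩ := hγ
  simp only [intCast_dEntry] at hk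
  have hu : IsUnit ((p : ZMod N) ^ k) := by
    rcases hk with hk | hk
    · exact hk ▸ isUnit_Gamma0Map N γ
    · have h := isUnit_Gamma0Map N γ
      rw [hk, IsUnit.neg_iff] at h
      exact h
  obtain ⟨g, hgood, hg⟩ := exists_isGoodAt_gamma0Map_eq_pow k hu
  have hcancel : Gamma0Map N (γ * g⁻¹) * Gamma0Map N g = Gamma0Map N γ := by
    rw [← map_mul, inv_mul_cancel_right]
  rcases hk with hk | hk
  · refine ⟨γ * g⁻¹, 1, g, ?_, Or.inl rfl, hgood, by group⟩
    rw [Gamma1_mem']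
    rw [hk, hg] at hcancel
    exact (hu.mul_left_inj).mp (hcancel.trans (one_mul _).symm)
  · refine ⟨γ * g⁻¹ * negOneGamma0 N, negOneGamma0 N, g, ?_, Or.inr rfl, hgood, ?_⟩
    · rw [Gamma1_mem']
      rw [hk, hg] at hcancel
      have h2 : Gamma0Map N (γ * g⁻¹) = -1 :=
        (hu.mul_left_inj).mp (hcancel.trans (neg_one_mul _).symm)
      rw [map_mul, h2, gamma0Map_negOneGamma0]
      norm_num
    · rw [mul_assoc (γ * g⁻¹), negOneGamma0_mul_negOneGamma0, mul_one, inv_mul_cancel_right]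

/-- `Γ₁(N) ⊆ Γ_H(N)` (`d ≡ 1 = p⁰`). [cite: Stevens1982, §1.1] -/
theorem inGammaH_of_mem_gamma1 {N : ℕ} (p : ℕ) {γ : Gamma0 N} (h : γ ∈ Gamma1' N) : InGammaH N p γ :=
  ⟨0, Or.inl (by simpa [intCast_dEntry] using h)⟩

/-- **`ConjSpanGen` reduces to `Γ₁(N)`**: it suffices (and is necessary) that every element of `Γ₁(N)` lie in
the span subgroup — «the image of `H₁(X₁(N))` in `H₁(X₀(N))` lies in the `p`-power winding span»
(memo §3). [cite: Manin1972, Prop. 1.4] [cite: Stevens1982, §1.1] -/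
theorem conjSpanGen_iff_gamma1 (N p : ℕ) :
    ConjSpanGen N p ↔ ∀ γ : Gamma0 N, γ ∈ Gamma1' N → γ ∈ spanSubgroup N p := by
  constructor
  · intro h γ hγ
    exact h γ (inGammaH_of_mem_gamma1 p hγ)
  · intro h γ hγ
    obtain ⟨δ, e, g, hδ, he, hg, rfl⟩ := hγ.exists_gamma1_mul
    refine mul_mem (mul_mem (h δ hδ) ?_)
      (mem_spanSubgroup_of_mem_spanGenerators (mem_spanGenerators_of_isGoodAt hg))
    rcases he with rfl | rfl
    · exact one_mem _
    · exact mem_spanSubgroup_of_mem_spanGenerators (negOneGamma0_mem_spanGenerators N p)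

/-- Membership in the span subgroup only depends on the class in the abelianization `Γ₀(N)ᵃᵇ` (it contains
the commutator subgroup `= ker (Γ₀(N) → Γ₀(N)ᵃᵇ)`). [cite: Manin1972, Prop. 1.4] -/
theorem mem_spanSubgroup_iff_abelianization {N p : ℕ} (γ : Gamma0 N) :
    γ ∈ spanSubgroup N p ↔
      Abelianization.of γ ∈ (Subgroup.closure (spanGenerators N p)).map Abelianization.of := by
  rw [spanSubgroup, ← Abelianization.ker_of, ← Subgroup.comap_map_eq, Subgroup.mem_comap]

/-- In `Γ₀(N)ᵃᵇ` powers distribute: `(δ x)ᵐ ≡ δᵐ xᵐ`, so `(δ x)ᵐ` is in the span subgroup as soon as `δᵐ` and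
`x` are. [cite: Manin1972, Prop. 1.4] -/
theorem mul_pow_mem_spanSubgroup {N p : ℕ} {δ x : Gamma0 N} {m : ℕ} (hδ : δ ^ m ∈ spanSubgroup N p)
    (hx : x ∈ spanSubgroup N p) : (δ * x) ^ m ∈ spanSubgroup N p := by
  rw [mem_spanSubgroup_iff_abelianization] at hδ hx ⊢
  rw [map_pow, map_mul, mul_pow, ← map_pow]
  exact mul_mem hδ (pow_mem hx m)

/-- **`EisSpanGen` reduces to `Γ₁(N)`** likewise: some prime-to-`p` power of every element of `Γ₁(N)` lies in
the span subgroup. [cite: Manin1972, Prop. 1.4] [cite: Stevens1982, §1.1] -/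
theorem eisSpanGen_iff_gamma1 (N p : ℕ) :
    EisSpanGen N p ↔
      ∀ γ : Gamma0 N, γ ∈ Gamma1' N → ∃ m : ℕ, ¬ p ∣ m ∧ γ ^ m ∈ spanSubgroup N p := by
  constructor
  · intro h γ hγ
    exact h γ (inGammaH_of_mem_gamma1 p hγ)
  · intro h γ hγ
    obtain ⟨δ, e, g, hδ, he, hg, rfl⟩ := hγ.exists_gamma1_mul
    obtain ⟨m, hpm, hm⟩ := h δ hδ
    refine ⟨m, hpm, ?_⟩
    rw [mul_assoc]
    refine mul_pow_mem_spanSubgroup hm (mul_mem ?_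
      (mem_spanSubgroup_of_mem_spanGenerators (mem_spanGenerators_of_isGoodAt hg)))
    rcases he with rfl | rfl
    · exact one_mem _
    · exact mem_spanSubgroup_of_mem_spanGenerators (negOneGamma0_mem_spanGenerators N p)

/-! #### The MOD-`p` form (cell referee R-68, `ref/REF-G5-R68-VSRef.lean`): what an `𝔽_p`-rank computation
certifies and what a mod-`p` functional argument consumes is «`pr Γ_H(N) ⊆ V(N,p) + p·H₁(X₀(N);ℤ)`», i.e. generation
modulo commutators AND `p`-th powers.  `EisSpanGen ⟹ EisSpanModGen` (Bezout); the converse fails as abstract group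
theory (`H₁/V ≅ ℤ/p²` over `Q ≅ ℤ/p`), so `EisSpanGen`/`ConjSpanGen` are the stronger integral statements. -/

/-- The `p`-th powers of `Γ₀(N)` (their classes span `p·H₁(X₀(N);ℤ)` under Manin's map).  VERBATIM the referee's
`pthPowers`. [cite: Manin1972, Prop. 1.4] -/
def pthPowers (N p : ℕ) : Set (Gamma0 N) := {g | ∃ h : Gamma0 N, g = h ^ p}

/-- The mod-`p` span subgroup: generated by `spanGenerators N p` and the `p`-th powers, times the commutator
subgroup. [cite: Manin1972, Prop. 1.4] -/
def spanModSubgroup (N p : ℕ) : Subgroup (Gamma0 N) :=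
  Subgroup.closure (spanGenerators N p ∪ pthPowers N p) ⊔ commutator (Gamma0 N)

/-- **`EisSpanModGen N p`** — the span statement MODULO `p`: every `γ ∈ Γ_H(N)` lies in
`⟨good ∪ finite-order ∪ trace ±2 ∪ p-th powers⟩ · [Γ₀(N), Γ₀(N)]`.  Through Manin 1972 Prop. 1.4:
`pr Γ_H(N) ⊆ V(N,p) + p·H₁(X₀(N);ℤ)`, i.e. `(H₁/V) ⊗ 𝔽_p → (H₁/pr Γ_H) ⊗ 𝔽_p` is an isomorphism, i.e. every additive
map `H₁(X₀(N);ℤ) → 𝔽_p` vanishing on the `p`-power winding classes factors through the Eisenstein quotient — the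
form an `𝔽_p`-rank computation of the winding span decides level by level (Sun 2007 App. B tabulates the possible
prime divisors of the index; at the levels with `p ∤ ∏_{q ∣ N} (q − 1)`, where the Eisenstein quotient has no
`p`-part, this is the `(p, ℓ) = (p, p)` case of statement (8) of Sun 2007 §4, summed over the layers `n`).  A PREDICATE on `(N, p)`; nothing asserted.  VERBATIM the referee's `EisSpanModGen`
(`spanModSubgroup` unfolded). [cite: Manin1972, Prop. 1.4] [cite: Sun2007, §4] -/
def EisSpanModGen (N p : ℕ) : Prop :=
  ∀ γ : Gamma0 N, InGammaH N p γ →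
    γ ∈ Subgroup.closure (spanGenerators N p ∪ pthPowers N p) ⊔ commutator (Gamma0 N)

/-- Unfolding `EisSpanModGen` through `spanModSubgroup`. [cite: Manin1972, Prop. 1.4] -/
theorem eisSpanModGen_iff (N p : ℕ) :
    EisSpanModGen N p ↔ ∀ γ : Gamma0 N, InGammaH N p γ → γ ∈ spanModSubgroup N p := Iff.rfl

/-- `spanSubgroup ≤ spanModSubgroup`. [cite: Manin1972, Prop. 1.4] -/
theorem spanSubgroup_le_spanModSubgroup (N p : ℕ) : spanSubgroup N p ≤ spanModSubgroup N p :=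
  sup_le_sup_right (Subgroup.closure_mono Set.subset_union_left) _

/-- `p`-th powers lie in `spanModSubgroup`. [cite: Manin1972, Prop. 1.4] -/
theorem pow_mem_spanModSubgroup (N p : ℕ) (γ : Gamma0 N) : γ ^ p ∈ spanModSubgroup N p :=
  Subgroup.mem_sup_left (Subgroup.subset_closure (Set.mem_union_right _ ⟨γ, rfl⟩))

/-- `ConjSpanGen ⟹ EisSpanModGen` (monotonicity). [cite: Manin1972, Prop. 1.4] -/
theorem eisSpanModGen_of_conjSpanGen {N p : ℕ} (h : ConjSpanGen N p) : EisSpanModGen N p :=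
  fun γ hγ ↦ spanSubgroup_le_spanModSubgroup N p (h γ hγ)

/-- **`EisSpanGen ⟹ EisSpanModGen`** (Bezout: `γ = (γᵐ)ᵘ · (γᵖ)ᵛ` with `u·m + v·p = 1`, `p ∤ m`).  The converse is
false as abstract group theory, so `EisSpanGen` is STRICTLY stronger than the mod-`p` statement an `𝔽_p`-rank engine
certifies (cell referee R-68; proof adapted from `ref/REF-G5-R68-VSRef.lean`). [cite: Manin1972, Prop. 1.4] -/
theorem eisSpanModGen_of_eisSpanGen {N p : ℕ} (hp : p.Prime) (h : EisSpanGen N p) : EisSpanModGen N p := by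
  intro γ hγ
  obtain ⟨m, hm, hmem⟩ := h γ hγ
  change γ ∈ spanModSubgroup N p
  have h1 : γ ^ m ∈ spanModSubgroup N p := spanSubgroup_le_spanModSubgroup N p hmem
  have h2 : γ ^ p ∈ spanModSubgroup N p := pow_mem_spanModSubgroup N p γ
  have hcop : Nat.Coprime m p := Nat.coprime_comm.mp ((Nat.Prime.coprime_iff_not_dvd hp).mpr hm)
  have hbez : (m : ℤ) * Nat.gcdA m p + (p : ℤ) * Nat.gcdB m p = 1 := by
    have := Nat.gcd_eq_gcd_ab m p
    rw [hcop] at this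
    exact_mod_cast this.symm
  have key : γ = (γ ^ m) ^ (Nat.gcdA m p) * (γ ^ p) ^ (Nat.gcdB m p) := by
    rw [← zpow_natCast, ← zpow_natCast, ← zpow_mul, ← zpow_mul, ← zpow_add, hbez, zpow_one]
  rw [key]
  exact mul_mem (Subgroup.zpow_mem _ h1 _) (Subgroup.zpow_mem _ h2 _)

/-- **`EisSpanModGen` reduces to `Γ₁(N)`** as well (same decomposition `γ = δ·e·g`). [cite: Manin1972, Prop. 1.4]
[cite: Stevens1982, §1.1] -/
theorem eisSpanModGen_iff_gamma1 (N p : ℕ) :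
    EisSpanModGen N p ↔ ∀ γ : Gamma0 N, γ ∈ Gamma1' N → γ ∈ spanModSubgroup N p := by
  constructor
  · intro h γ hγ
    exact h γ (inGammaH_of_mem_gamma1 p hγ)
  · intro h γ hγ
    obtain ⟨δ, e, g, hδ, he, hg, rfl⟩ := hγ.exists_gamma1_mul
    change δ * e * g ∈ spanModSubgroup N p
    refine mul_mem (mul_mem (h δ hδ) ?_) (spanSubgroup_le_spanModSubgroup N p
      (mem_spanSubgroup_of_mem_spanGenerators (mem_spanGenerators_of_isGoodAt hg)))
    rcases he with rfl | rfl
    · exact one_mem _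
    · exact spanSubgroup_le_spanModSubgroup N p
        (mem_spanSubgroup_of_mem_spanGenerators (negOneGamma0_mem_spanGenerators N p))

/-- Under «`(ℤ/N)ˣ = ⟨−1, p⟩`», `EisSpanModGen N p` says `spanModSubgroup N p = ⊤` («`V + p·H₁ = H₁`»: the mod-`p`
form of `bsd-f3-mu`'s prime-level statement, = verdict FULL of the `𝔽_p`-rank engine). [cite: Manin1972, Prop. 1.4] -/
theorem eisSpanModGen_iff_top_of_forall_isUnit {N p : ℕ}
    (h : ∀ x : ZMod N, IsUnit x → ∃ k : ℕ, x = (p : ZMod N) ^ k ∨ x = -((p : ZMod N) ^ k)) :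
    EisSpanModGen N p ↔ spanModSubgroup N p = ⊤ := by
  constructor
  · intro hC
    rw [eq_top_iff]
    intro γ _
    exact hC γ (inGammaH_of_forall_isUnit h γ)
  · intro htop γ _
    change γ ∈ spanModSubgroup N p
    rw [htop]
    exact Subgroup.mem_top γ

end GroupTheory

/-! ### §3 Layers: SINGLE-LAYER span statements (Sun 2007 §4: `M_n(ℓ) = ⟨{0, a/ℓⁿ}⟩` at ONE layer `n`) and the
two-layer consumer carrier — line «layered Stevens at 3» of cell `bsd-print-x8` (plan g5, `plan/ls/SketchLS.lean`,
predicates and lemmas VERBATIM; the class-wide `∀ N` statements `LayeredStevensModAt`, the bridge / collapse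
signatures `BridgeBy`/`BridgeLS`/`CollapseLS`/`RoadLS` stay Summits-side). -/

section Layers

variable {N : ℕ}

/-- Layer-`m` generating set: the good elements of EXACT layer `m` (`|d| = pᵐ`, i.e. `γ·0 = b/d` has denominator
exactly `pᵐ` — Sun's `(u a; Nv ℓᵐ) ↦ {0, a/ℓᵐ}`, one layer `M_m(ℓ)`), the finite-order and the trace-`±2`
elements (the last two die in `H₁(X₀(N);ℤ)`, Manin 1972 Prop. 1.4).  Compare `spanGenerators N p` (all layers).
VERBATIM `plan/ls/SketchLS.lean` `layerGenerators`. [cite: Sun2007, §4 (the map j_n and M_n(ℓ))]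
[cite: Manin1972, Prop. 1.4] -/
def layerGenerators (N p m : ℕ) : Set (Gamma0 N) :=
  {γ | (dEntry γ).natAbs = p ^ m ∨ IsOfFinOrder γ ∨ trEntry γ = 2 ∨ trEntry γ = -2}

/-- The good elements of EXACT layer `m` (`|d| = pᵐ`).  VERBATIM `plan/ls/SketchLS.lean` `goodLayer`.
[cite: Sun2007, §4 (the map j_n)] -/
def goodLayer (N p m : ℕ) : Set (Gamma0 N) := {γ | (dEntry γ).natAbs = p ^ m}

/-- The elements of `Γ₀(N)` that die in `H₁(X₀(N);ℤ)`: finite order (elliptic, `±I`) or trace `±2` (parabolic,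
`±I`).  VERBATIM `plan/ls/SketchLS.lean` `trivialGens`. [cite: Manin1972, Prop. 1.4] -/
def trivialGens (N : ℕ) : Set (Gamma0 N) := {γ | IsOfFinOrder γ ∨ trEntry γ = 2 ∨ trEntry γ = -2}

/-- The mod-`p` layer-`m` span subgroup: `⟨layer-m generators ∪ p-th powers⟩ · [Γ₀(N), Γ₀(N)]`.  VERBATIM
`plan/ls/SketchLS.lean` `layerSpanModSubgroup`. [cite: Manin1972, Prop. 1.4] -/
def layerSpanModSubgroup (N p m : ℕ) : Subgroup (Gamma0 N) :=
  Subgroup.closure (layerGenerators N p m ∪ pthPowers N p) ⊔ commutator (Gamma0 N)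

/-- **`LayerEisSpanModGen N p m`** — LAYER-EIS-SPAN`(N,p,m)` modulo `p`, in `Γ₁(N)`-form: every `γ ∈ Γ₁(N)` lies in the
mod-`p` layer-`m` span subgroup.  Through Manin 1972 Prop. 1.4: every additive map `H₁(X₀(N);ℤ) → 𝔽_p` killing the
layer-`m` classes `{0 → a/pᵐ}` (`p ∤ a`) factors through `d mod N`, i.e. through the Eisenstein quotient
`(ℤ/N)ˣ/⟨±pᵐ, parabolic, elliptic⟩ ⊗ 𝔽_p` — what an `𝔽_p`-rank computation at ONE layer certifies.  Sun 2007 §4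
statement (8) is the integral index form at one layer `n` for `(p, ℓ)` with `p ∤ ∏_{q∣N}(q−1)`, his Example 9 the case
`N = 11`, `ℓ = 3` (`[H₁(X₀(11);ℤ) : M_k(3)] ∈ {1, 5}`).  A PREDICATE on `(N, p, m)`; nothing asserted.  VERBATIM
`plan/ls/SketchLS.lean` `LayerEisSpanModGen`. [cite: Sun2007, §4 (8) and Example 9] [cite: Manin1972, Prop. 1.4] -/
def LayerEisSpanModGen (N p m : ℕ) : Prop :=
  ∀ γ : Gamma0 N, γ ∈ Gamma1' N → γ ∈ layerSpanModSubgroup N p m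

/-- Two CONSECUTIVE layers `m, m + 1` with `m ≥ 1` satisfy LAYER-EIS-SPAN mod `p` (what a both-parity consumer needs).
A PREDICATE on `(N, p)`.  VERBATIM `plan/ls/SketchLS.lean` `LayerEisSpanTwoModGen`. [cite: Sun2007, §4 (8)] -/
def LayerEisSpanTwoModGen (N p : ℕ) : Prop :=
  ∃ m : ℕ, 1 ≤ m ∧ LayerEisSpanModGen N p m ∧ LayerEisSpanModGen N p (m + 1)

/-- `SpanModBy N p S`: `Γ₁(N) ⊆ ⟨S ∪ trivial ∪ p-th powers⟩ · [Γ₀(N), Γ₀(N)]` — «the classes of the test set `S` span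
`pr Γ₁(N)` in `H₁(X₀(N);𝔽_p)` up to the Eisenstein part»; `S = goodLayer N p m` gives `LayerEisSpanModGen`
(`spanModBy_goodLayer_iff`).  A PREDICATE.  VERBATIM `plan/ls/SketchLS.lean` `SpanModBy`. [cite: Manin1972, Prop. 1.4] -/
def SpanModBy (N p : ℕ) (S : Set (Gamma0 N)) : Prop :=
  ∀ γ : Gamma0 N, γ ∈ Gamma1' N →
    γ ∈ Subgroup.closure (S ∪ trivialGens N ∪ pthPowers N p) ⊔ commutator (Gamma0 N)

/-- Layer-`m` generators are generators. [cite: Manin1972, Prop. 1.4] -/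
theorem layerGenerators_subset_spanGenerators (N p m : ℕ) :
    layerGenerators N p m ⊆ spanGenerators N p := by
  intro γ hγ
  rcases hγ with h | h | h | h
  · exact Or.inl ⟨m, h⟩
  · exact Or.inr (Or.inl h)
  · exact Or.inr (Or.inr (Or.inl h))
  · exact Or.inr (Or.inr (Or.inr h))

/-- The layer-`m` mod-`p` span subgroup lies in the all-layer one. [cite: Manin1972, Prop. 1.4] -/
theorem layerSpanModSubgroup_le (N p m : ℕ) :
    layerSpanModSubgroup N p m ≤ spanModSubgroup N p :=
  sup_le_sup_right (Subgroup.closure_mono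
    (Set.union_subset_union_left _ (layerGenerators_subset_spanGenerators N p m))) _

/-- ONE certified layer already gives the all-layer mod-`p` statement `EisSpanModGen` (through the reduction to
`Γ₁(N)`, `eisSpanModGen_iff_gamma1`).  VERBATIM `plan/ls/SketchLS.lean`. [cite: Manin1972, Prop. 1.4] -/
theorem eisSpanModGen_of_layerEisSpanModGen {N p m : ℕ} (h : LayerEisSpanModGen N p m) :
    EisSpanModGen N p :=
  (eisSpanModGen_iff_gamma1 N p).mpr fun γ hγ ↦ layerSpanModSubgroup_le N p m (h γ hγ)

/-- `layerGenerators = goodLayer ∪ trivialGens`. [cite: Manin1972, Prop. 1.4] -/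
theorem layerGenerators_eq (N p m : ℕ) : layerGenerators N p m = goodLayer N p m ∪ trivialGens N := by
  ext γ; simp [layerGenerators, goodLayer, trivialGens]

/-- `SpanModBy` at the test set `goodLayer N p m` is `LayerEisSpanModGen N p m`. [cite: Manin1972, Prop. 1.4] -/
theorem spanModBy_goodLayer_iff (N p m : ℕ) :
    SpanModBy N p (goodLayer N p m) ↔ LayerEisSpanModGen N p m := by
  simp only [SpanModBy, LayerEisSpanModGen, layerSpanModSubgroup, layerGenerators_eq]

/-- `SpanModBy` is monotone in the test set. [cite: Manin1972, Prop. 1.4] -/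
theorem SpanModBy.mono {N p : ℕ} {S S' : Set (Gamma0 N)} (hSS' : S ⊆ S') (h : SpanModBy N p S) :
    SpanModBy N p S' :=
  fun γ hγ ↦ sup_le_sup_right (Subgroup.closure_mono
    (Set.union_subset_union_left _ (Set.union_subset_union_left _ hSS'))) _ (h γ hγ)

/-- `SpanModBy` at the test set of ALL good elements is `EisSpanModGen` (`Γ₁(N)`-form, `eisSpanModGen_iff_gamma1`).
[cite: Manin1972, Prop. 1.4] -/
theorem spanModBy_setOf_isGoodAt_iff (N p : ℕ) :
    SpanModBy N p {γ : Gamma0 N | IsGoodAt p γ} ↔ EisSpanModGen N p := by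
  have hS : {γ : Gamma0 N | IsGoodAt p γ} ∪ trivialGens N = spanGenerators N p := by
    ext γ; simp [IsGoodAt, trivialGens, spanGenerators]
  rw [eisSpanModGen_iff_gamma1]
  simp only [SpanModBy, spanModSubgroup, hS]

end Layers

section TwoLayerCarrier

/-- **Consumer carrier `CycWindingUnitTwoLayersAt W p`**: for every newform `f` of `W` there is a layer `m ≥ 1` and
numerators `b, b'` prime to `p` with `1 ≤ ‖[b/pᵐ]⁺_f − [0]⁺_f‖_p` and `1 ≤ ‖[b'/pᵐ⁺¹]⁺_f − [0]⁺_f‖_p` — unit differences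
of plus symbols (Mazur–Tate–Teitelbaum 1986 §I.10 (10.1)) at two CONSECUTIVE exact layers, the input of a both-parity
Mazur–Tate reading.  Refines `CycWindingNonConstantAt` (`cycWindingNonConstantAt_of_cycWindingUnitTwoLayersAt`).
A PREDICATE on `(W, p)`; nothing asserted.  VERBATIM `plan/ls/SketchLS.lean` `CycWindingUnitTwoLayersAt`.
[cite: MazurTateTeitelbaum1986Invent, §I.10 (10.1)] [cite: Sun2007, §4] -/
def CycWindingUnitTwoLayersAt (W : WeierstrassCurve ℚ) [W.IsGloballyMinimal] (p : ℕ) [Fact p.Prime] : Prop :=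
  ∀ {N : ℕ} [NeZero N] (f : CuspForm (Gamma0 N) 2), IsNewformOf W f →
    ∃ (m : ℕ) (b b' : ℤ), 1 ≤ m ∧ ¬ (p : ℤ) ∣ b ∧ ¬ (p : ℤ) ∣ b' ∧
      1 ≤ ‖((ratPlusSymbol f ((b : ℚ) / (p : ℚ) ^ m) - ratPlusSymbol f 0 : ℚ) : ℚ_[p])‖ ∧
      1 ≤ ‖((ratPlusSymbol f ((b' : ℚ) / (p : ℚ) ^ (m + 1)) - ratPlusSymbol f 0 : ℚ) : ℚ_[p])‖

variable {W : WeierstrassCurve ℚ} [W.IsGloballyMinimal] {p : ℕ} [Fact p.Prime]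

/-- The two-layer carrier refines the winding carrier `CycWindingNonConstantAt` (take `a'/pⁿ' = 0/p⁰`).  VERBATIM
`plan/ls/SketchLS.lean`. [cite: MazurTateTeitelbaum1986Invent, §I.10 (10.1)] -/
theorem cycWindingNonConstantAt_of_cycWindingUnitTwoLayersAt (h : CycWindingUnitTwoLayersAt W p) :
    CycWindingNonConstantAt W p := by
  rw [cycWindingNonConstantAt_iff_twoLevel]
  intro N _ f hf
  obtain ⟨m, b, b', -, -, -, h1, -⟩ := h f hf
  refine ⟨m, 0, b, 0, ?_⟩
  simpa using h1

/-- Level transport for the two-layer carrier: ONE newform decides (Carayol's `hlev`, as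
`cycWindingNonConstantAt_iff_of_isNewformOf`). [cite: Carayol1986] -/
theorem cycWindingUnitTwoLayersAt_iff_of_isNewformOf [W.IsElliptic]
    (hlev : ∀ (N : ℕ) [NeZero N], IsNewformOf.level_eq_conductorNorm (N := N))
    {N : ℕ} [NeZero N] {f : CuspForm (Gamma0 N) 2} (hf : IsNewformOf W f) :
    CycWindingUnitTwoLayersAt W p ↔
      ∃ (m : ℕ) (b b' : ℤ), 1 ≤ m ∧ ¬ (p : ℤ) ∣ b ∧ ¬ (p : ℤ) ∣ b' ∧
        1 ≤ ‖((ratPlusSymbol f ((b : ℚ) / (p : ℚ) ^ m) - ratPlusSymbol f 0 : ℚ) : ℚ_[p])‖ ∧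
        1 ≤ ‖((ratPlusSymbol f ((b' : ℚ) / (p : ℚ) ^ (m + 1)) - ratPlusSymbol f 0 : ℚ) : ℚ_[p])‖ := by
  constructor
  · intro h
    exact h f hf
  · intro h M _ f₁ hf₁
    obtain rfl : M = W.conductorNorm ℤ := hlev M hf₁
    obtain rfl : N = W.conductorNorm ℤ := hlev N hf
    obtain rfl : f₁ = f := hf₁.unique hf
    exact h

end TwoLayerCarrier

end Literature.NumberTheory.EllipticCurves.Rank1Residual

end
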